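import Summits.QuantumFields.YangMills.Theorems.BalabanUVNodesN17AtRecord9
import Literature.MathematicalPhysics.QuantumFieldTheory.Balaban1983to89.Node00.Record11CarriersB8

/-!
# BalabanUVNodes ∕ node N17 = NE4 AT NODE 00's STAGE-11 RECORD `Node00.IsRecordOfRecord₁₁C` (def-T `Node00/Record11.lean` p444286): the Stage-11
# datum carries def-T's CONTINUOUS-VERSION β of record (`βfun_datumOfRecord₁₁ = betaOfRecord₁₀ θ.toStage9Params = betaOfRecord₉c`, `rfl`) = the merged β of
# the `(TcOfRecord, chiFixed7 θ.ν)` term family at the chart `(θ.ρ8, θ.bV)`; every N17 face holds there BY NAME; in-edges n15 ∕ n16 ∕ (D4) as hypotheses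

Cell `pub-ymgap`, HUMAN RULING D-0062, seat `pub-ymgap-dag-n17-c` (R134 fan-out, strategy s2 = BY-NAME KNIT AT THE ₁₁ RECORD), companion 9 (§31–§33) of
`BalabanUVNodesN17Knit` … `…N17AtRecord9` (p422174).  THEOREMS ONLY; imports companion 8 `…N17AtRecord9` (hence companions 4–7 and module 2's `N17At ∕ S_N17 ∕
U3Carriers ∕ RateCarriers ∕ RateRecordPred ∕ ReadOutAt`) and def-T's ∕ node00-def's `Node00/Record11` ⊆ `Record11Carriers` ⊆ `Record11CarriersB8`
(`Stage11Params`, `.Admissible` with `.toStage9`, `.Provisos₁₁` with `.base ∕ .hasContTransportAlong`, `datumOfRecord₁₁`, `βfun_datumOfRecord₁₁`,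
`IsRecordOfRecord₁₁C`, `exists_isRecordOfRecord₅C_of_isRecordOfRecord₁₁C`, `IsRecordOfRecord₁₁CB10YZW(B8)`); modifies nothing; every cited lemma used BY NAME.

THE POINT.  `IsRecordOfRecord₁₁C F N D w := ∃ (θ : Stage11Params F N) (h : θ.Provisos₁₁), θ.Admissible ∧ D = datumOfRecord₁₁ F N θ h ∧ w.C = D.C ∧
(0 < w.γ ∧ w.γ ≤ θ.γ) ∧ …` (Record11 §7).  The Stage-11 datum is a TOWER datum whose β-functions ARE Stage 10's re-pointed β:
`(datumOfRecord₁₁ F N θ h).βfun = betaOfRecord₁₀ F N θ.toStage9Params` (`βfun_datumOfRecord₁₁`, `rfl`) `= betaOfRecord₉c = betaOfRecord₈T (TcOfRecord) θ₈`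
(`Node00/ContinuousTransportOfRecord`), and by `rfl` this IS the definer's assembly line
`betaOfMerged βmT (beta0OfMerged βmT θ.v₀) θ.γ`, `βmT := betaMerged F (mergedTermFamilyMatT F N (TcOfRecord F N) (chiFixed7 F N θ.ν) θ.εbg) θ.ρ8 θ.bV`
(§31 `βfun_datumOfRecord₁₁_eq_mergedT`) — [I] (1.20)–(1.22) on the merged term (1.6) with every input `A_{k+1}`, `𝐍_k` read through the CONTINUOUS-VERSION
transport `TcOfRecord` and def-χ's flow-blind `chiFixed7`.  THIS IS NOT STAGE 8's `βm₈` (`chi7`, Radon–Nikodym transport): the ₉-companion's β-VERSION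
sentence (RIDER №6 ∕ director-ym LINE №44 (b)) is DISCHARGED BY CONSTRUCTION at ₁₁ — `Provisos₁₁.base.contT = HasContTransportAlong` is a CLAUSE the record
certifies (§32 `exists_chart_scaleShiftRate_of_N17₁₁` carries it in its conclusion) — nothing below is a `βfun`-congruence IOU.  N17 reads the datum ONLY
through `βfun` (companion 6 `YMDAG.N17.n17At_congr_βfun`), so the tower ∕ §2-[III]-format pins of ₁₁ (`S218OfRecord₁₁`, `ScorrLawOfRecord₁₁`, `Rz ∕ Wt`) do NOT
touch the N17 row, and `Stage11Params.Admissible := Stage-9 admissibility ∧ s2.Pos` CARRIES the ₈X chart clause (`Admissible.toStage9.chart`), so every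
∀-form below is asked of CHARTED witnesses only (R448 (1) at ₁₁).
* §31 AT THE STAGE-11 DATUM: `βfun_datumOfRecord₁₁_eq_mergedT` (`rfl`), `βfun_datumOfRecord₁₁_eq_stage10` (same `βfun` as the Stage-10 datum of
  `θ.toStage9Params`), `N17_datumOfRecord₁₁_iff_stage10`, **`N17_datumOfRecord₁₁_iff_merged`** (box `γ' ≤ θ.γ`: N17 at the Stage-11 datum ↔ the η-rate of
  `βmT`), `u2Inputs_datumOfRecord₁₁_iff`, `n17At_datumOfRecord₁₁_iff_merged` (K4's letters), `N17_datumOfRecord₁₁_of_rates` (THE SPLIT ROAD: (AF-0r) for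
  `beta0OfMerged βmT θ.v₀` — N15 = NE2's currency — ∧ the merged remainder's rate — N16 = NE3 ∕ N18 = NE5), `content_of_N17_datumOfRecord₁₁` (what N17
  DELIVERS), `N17_datumOfRecord₁₁_of_kernelStepRate` (KERNEL CURRENCY: (UD) ∧ the history-matched step rate of the record's OWN `Node00.polLimit` kernels of the
  `(TcOfRecord, chiFixed7)` family — N15 ∕ N16 ∕ N18 in the record's letters), `N17_datumOfRecord₁₁_iff_of_lt` (the box CAP as an `iff`).
* §32 AT THE RECORD PREDICATE ₁₁C (∀-forms over admissible `Stage11Params` WITH `Provisos₁₁` realising `D`): **`N17_of_isRecordOfRecord₁₁C`**,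
  `N17_of_isRecordOfRecord₁₁C_rates`, `N17_of_isRecordOfRecord₁₁C_kernelStepRate`, `u2Inputs_of_isRecordOfRecord₁₁C` (the N17 → N27 edge's input),
  **`exists_chart_scaleShiftRate_of_N17₁₁`** (`2 ≤ N`: N17 at a ₁₁C record IS an η-rate of `βmT` through a chart with `ρ8 ≠ 0` AT A WITNESS CERTIFYING
  `HasContTransportAlong`), `af0r_of_N17_isRecordOfRecord₁₁C` (N17 DELIVERS (AF-0r) for the record's one-loop numbers, given `Beta0LimitExists` at coherent
  admissible `θ.v₀`), `exists_shadow₅_N17_iff₁₁`, `N17_of_isRecordOfRecord₁₁CB10YZW` ∕ `…B8` (the same at node00-def's carrier-pinned records).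
* §33 THE K4 LINK AT ₁₁: **`s_N17_of_stage11_slot`** (`S_N17 RRec` for EVERY rate-record predicate whose bundles come with an admissible Stage-11
  witness-with-provisos realising the datum, `R.u3.γ ≤ θ.γ`, and the `βmT` rate at `R.u3`'s letters), `s_N17_of_rec₁₁C` (the same for an `RRec` home typed
  «`∃ w, IsRecordOfRecord₁₁C F N D w ∧ R.u3.γ = w.γ`»), `readOutAt_datumOfRecord₁₁_iff_stage10` (THE U3 ROAD at ₁₁: module 2's (D4) binders `ReadOutAt` at the
  Stage-11 datum = at the Stage-10 datum; companion 6's stage-free `YMDAG.N17.s_N17_of_D4_N18 : S_D4 RRec → S_N18 RRec → S_N17 RRec` and `n17At_of_readOutAt` ∕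
  `n17At_of_transferModel` (roster IN n15 ∕ n16) apply VERBATIM at `D := datumOfRecord₁₁ F N θ h` — not restated).
NO INHABITANT of `IsRecordOfRecord₁₁C` is claimed (inhabitation is EXACTLY «some admissible θ satisfies `Provisos₁₁`», K0 = stmt-QuantumFields-19673); nothing
needs a junk guard.  `IsRecordOfRecord₁₁C → IsRecordOfRecord₁₀C ∕ ₉C` does NOT hold at the datum (Record11's located note); N17 needs only `βfun` equality, which
holds with the ₁₀ datum (`rfl`) and with the ₅C shadow.

HONEST FRAMING.  Kernel bookkeeping BY NAME; 0 sorry; NE4 NOT IN PRINT ([Balaban1987RG1] (1.20)–(1.22) p. 264, p. 298) and NOT PROVED; every rate input a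
displayed HYPOTHESIS (rows NE2 ∕ NE3 ∕ NE5 = N15 ∕ N16 ∕ N18 and (D4) through (1.22); (UD) = (5.10) p. 293 printed for Bałaban's kernels, a hypothesis here;
(AF-0r) = GAPS G-an2-4); the Stage-11 provisos are never assumed except as the record predicate's own conjunct; nothing of Bałaban's asserted; N17 NOT
discharged; «A: n∕28» unmoved.  One finite four-torus at fixed ε per run — NOT infinite volume, NOT OS on ℝ⁴, NOT a mass gap, NOT Clay.
-/

noncomputable section

open scoped Matrix.Norms.L2Operator

namespace Summit.QuantumFields.YangMills.Theorems.BalabanUVNodesN17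

open Filter Topology
open Literature.MathematicalPhysics.QuantumFieldTheory.Balaban1983to89
open Literature.MathematicalPhysics.QuantumFieldTheory.Balaban1983to89.FlowStep
open Literature.MathematicalPhysics.QuantumFieldTheory.Balaban1983to89.T4CouplingMatching
open Literature.MathematicalPhysics.QuantumFieldTheory.Balaban1983to89.T4Continuum (T4Family FiniteEpsData ULoop)
open Literature.MathematicalPhysics.QuantumFieldTheory.Balaban1983to89.B12Sec2to5 (Decay510 betaPrime510)
open Literature.MathematicalPhysics.QuantumFieldTheory.Balaban1983to89.Beta.LimitRate (subKernel)
open Literature.MathematicalPhysics.QuantumFieldTheory.Balaban1983to89.Node00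
open Literature.MathematicalPhysics.QuantumFieldTheory.Balaban1983to89.DagBinding (WorldP)
open Summit.QuantumFields.BalabanUV.T4Continuum.Spine.NE4 (NE4OnData U2Inputs ne4OnData_iff)
open YMDAG.UVSplit (Datum U3Carriers RateCarriers RateRecordPred N17At S_N17)

variable {F : T4Family} {N : ℕ} [NeZero N]

/-! ## §31 N17 AT THE STAGE-11 DATUM `datumOfRecord₁₁ F N θ h` — `βfun` IS the `(TcOfRecord, chiFixed7)` assembly line (`rfl`) -/

/-- **THE STAGE-11 DATUM's β-FUNCTIONS ARE THE DEFINER's ASSEMBLY LINE OVER THE CONTINUOUS-VERSION TRANSPORT** (`rfl` through `βfun_datumOfRecord₁₁`,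
`betaOfRecord₁₀`, `betaOfRecord₉c_eq`, `betaOfRecord₈T`): `βfun = betaOfMerged βmT (beta0OfMerged βmT θ.v₀) θ.γ` with
`βmT = betaMerged F (mergedTermFamilyMatT F N (TcOfRecord F N) (chiFixed7 F N θ.ν) θ.εbg) θ.ρ8 θ.bV`. [cite: Balaban1987RG1, (1.20)-(1.22) p.264] -/
theorem βfun_datumOfRecord₁₁_eq_mergedT (θ : Stage11Params F N) (h : θ.Provisos₁₁) :
    (datumOfRecord₁₁ F N θ h).βfun =
      letI := θ.instVβ₁; letI := θ.instVβ₂; letI := θ.instιβ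
      betaOfMerged (betaMerged F (mergedTermFamilyMatT F N (TcOfRecord F N) (chiFixed7 F N θ.ν) θ.εbg) θ.ρ8 θ.bV)
        (beta0OfMerged (betaMerged F (mergedTermFamilyMatT F N (TcOfRecord F N) (chiFixed7 F N θ.ν) θ.εbg) θ.ρ8 θ.bV) θ.v₀) θ.γ := rfl

/-- **THE STAGE-11 DATUM AND THE STAGE-10 DATUM OF ITS STAGE-9 PART HAVE THE SAME β-FUNCTIONS** [bookkeeping] (`βfun_datumOfRecord₁₁`, `βfun_datumOfRecord₁₀`,
both `rfl`; `h.base : θ.toStage9Params.Provisos₁₀`): the §2 [III] format pin re-keys the 𝐑-leaf and the core's `Sect2Form`, not β.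
[cite: Balaban1987RG1, (1.20)-(1.22) p.264] -/
theorem βfun_datumOfRecord₁₁_eq_stage10 (θ : Stage11Params F N) (h : θ.Provisos₁₁) :
    (datumOfRecord₁₁ F N θ h).βfun = (datumOfRecord₁₀ F N θ.toStage9Params h.base).βfun := rfl

/-- **N17 AT THE STAGE-11 DATUM IS N17 AT THE STAGE-10 DATUM** [bookkeeping] — on every box, with every constant and rate (N17 reads `βfun` only).
[cite: Balaban1987RG1, (1.20)-(1.22) p.264] -/
theorem N17_datumOfRecord₁₁_iff_stage10 (θ : Stage11Params F N) (h : θ.Provisos₁₁) (c ρ γ' : ℝ) :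
    NE4OnData (datumOfRecord₁₁ F N θ h) c ρ γ' ↔ NE4OnData (datumOfRecord₁₀ F N θ.toStage9Params h.base) c ρ γ' := by
  rw [ne4OnData_iff, ne4OnData_iff, βfun_datumOfRecord₁₁_eq_stage10]

/-- **N17 AT THE STAGE-11 DATUM READS THE CONTINUOUS-VERSION MERGED β** on every box side `γ' ≤ θ.γ`:
`NE4OnData (datumOfRecord₁₁ F N θ h) c ρ γ' ↔ ScaleShiftRate c ρ γ' βmT` (companion 4 `N17_atRecord_iff_merged` at `βfun_datumOfRecord₁₁_eq_mergedT`).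
[cite: Balaban1987RG1, (1.20)-(1.22) p.264] -/
theorem N17_datumOfRecord₁₁_iff_merged (θ : Stage11Params F N) (h : θ.Provisos₁₁) {c ρ γ' : ℝ} (hγ : γ' ≤ θ.γ) :
    NE4OnData (datumOfRecord₁₁ F N θ h) c ρ γ' ↔
      letI := θ.instVβ₁; letI := θ.instVβ₂; letI := θ.instιβ
      ScaleShiftRate c ρ γ'
        (betaMerged F (mergedTermFamilyMatT F N (TcOfRecord F N) (chiFixed7 F N θ.ν) θ.εbg) θ.ρ8 θ.bV) :=
  N17_atRecord_iff_merged _ (βfun_datumOfRecord₁₁_eq_mergedT θ h) hγ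

/-- **NODE U2's INPUT TRIPLE AT THE STAGE-11 DATUM** (box `γ' ≤ θ.γ`): `U2Inputs D₁₁ c C ρ γ' Λ ↔` the `βmT` rate ∧ its history moduli ∧ the β-free
fading-memory clause (companion 4 `u2Inputs_atRecord_iff`). [cite: Balaban1987RG1, §5 p.298] -/
theorem u2Inputs_datumOfRecord₁₁_iff (θ : Stage11Params F N) (h : θ.Provisos₁₁) {c C ρ γ' : ℝ} {Λ : ℕ → ℕ → ℝ} (hγ : γ' ≤ θ.γ) :
    U2Inputs (datumOfRecord₁₁ F N θ h) c C ρ γ' Λ ↔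
      letI := θ.instVβ₁; letI := θ.instVβ₂; letI := θ.instιβ
      ScaleShiftRate c ρ γ' (betaMerged F (mergedTermFamilyMatT F N (TcOfRecord F N) (chiFixed7 F N θ.ν) θ.εbg) θ.ρ8 θ.bV) ∧
        HistLipschitz Λ γ' (betaMerged F (mergedTermFamilyMatT F N (TcOfRecord F N) (chiFixed7 F N θ.ν) θ.εbg) θ.ρ8 θ.bV) ∧
        FadingMemory C ρ Λ :=
  u2Inputs_atRecord_iff _ (βfun_datumOfRecord₁₁_eq_mergedT θ h) hγ

/-- **… IN CLUSTER K4's LETTERS** [bookkeeping]: for node U3's carriers `u` with `u.γ ≤ θ.γ`, `N17At (datumOfRecord₁₁ F N θ h) u ↔` the `βmT` rate at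
the dependent letters `(u.cr·u.C₅·u.θ, u.ρ, u.γ)` (module 2's `N17At` = `NE4OnData` at those letters). [cite: Balaban1987RG1, (1.20)-(1.22) p.264] -/
theorem n17At_datumOfRecord₁₁_iff_merged (θ : Stage11Params F N) (h : θ.Provisos₁₁) (u : U3Carriers) (hγ : u.γ ≤ θ.γ) :
    N17At (datumOfRecord₁₁ F N θ h) u ↔
      letI := θ.instVβ₁; letI := θ.instVβ₂; letI := θ.instιβ
      ScaleShiftRate (u.cr * u.C₅ * u.θ) u.ρ u.γ
        (betaMerged F (mergedTermFamilyMatT F N (TcOfRecord F N) (chiFixed7 F N θ.ν) θ.εbg) θ.ρ8 θ.bV) :=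
  N17_datumOfRecord₁₁_iff_merged θ h hγ

/-- **THE SPLIT ROAD AT THE STAGE-11 DATUM** («β⁰ conv + β¹ shift», companion 4 §14 at `βfun_datumOfRecord₁₁_eq_mergedT`): (AF-0r)
`|β⁰_{k+1} − β⁰_∞| ≤ c₀ρ^k` for the record's NAMED one-loop number `β⁰ := beta0OfMerged βmT θ.v₀` (N15 = NE2's currency, GAPS G-an2-4) ∧
`ScaleShiftRate c₁ ρ γ' (βmT − β⁰)` for the merged remainder (N16 = NE3 ∕ N18 = NE5), `γ' ≤ θ.γ`, `0 ≤ ρ ≤ 1`, `0 ≤ c₀` ⟹ `NE4OnData D₁₁ (2c₀ + c₁) ρ γ'`.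
Both binders UNPRINTED. [cite: Balaban1987RG1, (2.12)-(2.14) p.268] -/
theorem N17_datumOfRecord₁₁_of_rates (θ : Stage11Params F N) (h : θ.Provisos₁₁) {binf c₀ c₁ ρ γ' : ℝ} (hγ : γ' ≤ θ.γ) (hρ0 : 0 ≤ ρ)
    (hρ1 : ρ ≤ 1) (hc₀ : 0 ≤ c₀)
    (hconv : letI := θ.instVβ₁; letI := θ.instVβ₂; letI := θ.instιβ
      ∀ k, |beta0OfMerged (betaMerged F (mergedTermFamilyMatT F N (TcOfRecord F N) (chiFixed7 F N θ.ν) θ.εbg) θ.ρ8 θ.bV) θ.v₀ k - binf| ≤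
        c₀ * ρ ^ k)
    (hrem : letI := θ.instVβ₁; letI := θ.instVβ₂; letI := θ.instιβ
      ScaleShiftRate c₁ ρ γ' fun k w =>
        betaMerged F (mergedTermFamilyMatT F N (TcOfRecord F N) (chiFixed7 F N θ.ν) θ.εbg) θ.ρ8 θ.bV k w -
          beta0OfMerged (betaMerged F (mergedTermFamilyMatT F N (TcOfRecord F N) (chiFixed7 F N θ.ν) θ.εbg) θ.ρ8 θ.bV) θ.v₀ k) :
    NE4OnData (datumOfRecord₁₁ F N θ h) (2 * c₀ + c₁) ρ γ' :=
  N17_atRecord_of_rates _ (βfun_datumOfRecord₁₁_eq_mergedT θ h) hγ hρ0 hρ1 hc₀ hconv hrem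

/-- **WHAT N17 DELIVERS AT THE STAGE-11 DATUM.**  On a box side `0 < γ' ≤ θ.γ` with `0 ≤ ρ < 1`: if the definer's one-sided limit `Beta0LimitExists βmT θ.v₀`
holds at COHERENT reference histories with entries in `]0,γ']`, then `NE4OnData D₁₁ c ρ γ'` ALONE yields (AF-0r) `∃ β⁰_∞, |β⁰_{k+1} − β⁰_∞| ≤ (c∕(1−ρ))ρ^k` for
the record's one-loop number `beta0OfMerged βmT θ.v₀` AND the merged remainder's rate — the node's β⁰-half is an OUTPUT feeding the `hconv` consumers of
NODE O ∕ K2 (companion 4 `atRecord_content_of_scaleShiftRate_merged`). [cite: Balaban1987RG1, (2.12)-(2.14) p.268] -/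
theorem content_of_N17_datumOfRecord₁₁ (θ : Stage11Params F N) (h : θ.Provisos₁₁) {c ρ γ' : ℝ} (hγ : γ' ≤ θ.γ) (hγ' : 0 < γ')
    (hρ0 : 0 ≤ ρ) (hρ1 : ρ < 1)
    (hlim : letI := θ.instVβ₁; letI := θ.instVβ₂; letI := θ.instιβ
      Beta0LimitExists (betaMerged F (mergedTermFamilyMatT F N (TcOfRecord F N) (chiFixed7 F N θ.ν) θ.εbg) θ.ρ8 θ.bV) θ.v₀)
    (hcoh : ∀ k, Fin.tail (θ.v₀ (k + 1)) = θ.v₀ k) (hadm : ∀ k i, 0 < θ.v₀ k i ∧ θ.v₀ k i ≤ γ')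
    (hN17 : NE4OnData (datumOfRecord₁₁ F N θ h) c ρ γ') :
    letI := θ.instVβ₁; letI := θ.instVβ₂; letI := θ.instιβ
    (∃ binf : ℝ, ∀ k,
        |beta0OfMerged (betaMerged F (mergedTermFamilyMatT F N (TcOfRecord F N) (chiFixed7 F N θ.ν) θ.εbg) θ.ρ8 θ.bV) θ.v₀ k - binf| ≤
          c / (1 - ρ) * ρ ^ k) ∧
      ScaleShiftRate (c + 2 * (c / (1 - ρ))) ρ γ' (fun k w =>
        betaMerged F (mergedTermFamilyMatT F N (TcOfRecord F N) (chiFixed7 F N θ.ν) θ.εbg) θ.ρ8 θ.bV k w -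
          beta0OfMerged (betaMerged F (mergedTermFamilyMatT F N (TcOfRecord F N) (chiFixed7 F N θ.ν) θ.εbg) θ.ρ8 θ.bV) θ.v₀ k) := by
  letI := θ.instVβ₁; letI := θ.instVβ₂; letI := θ.instιβ
  exact (atRecord_content_of_scaleShiftRate_merged hγ hγ' hρ0 hρ1 hlim hcoh hadm ((N17_datumOfRecord₁₁_iff_merged θ h hγ).mp hN17)).2

/-- **N17 AT THE STAGE-11 DATUM END TO END IN KERNEL CURRENCY** (companion 4 `N17_atAssemblyLine_of_kernelStepRate` at `βfun_datumOfRecord₁₁_eq_mergedT`):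
(UD) — (5.10)-decay of the record's OWN limiting polarisation kernels `polLimit F (k+1) (ℰT k v ·) θ.ρ8 θ.bV` of the `(TcOfRecord, chiFixed7)` family on the
boxes `]0,γ']` — ∧ their HISTORY-MATCHED STEP RATE `|Π_{k+2}(w; x) − Π_{k+1}(tail w; x)| ≤ C′ρ^k e^{−δ′|x|₁}`, `0 < γ' ≤ θ.γ`, `0 ≤ ρ < 1`, `Beta0LimitExists` at
coherent admissible `θ.v₀` ⟹ `NE4OnData D₁₁ (β′(C′,δ′)) ρ γ'` ∧ (AF-0r) for `beta0OfMerged βmT θ.v₀`.  (UD) PRINTED for Bałaban's kernels, a hypothesis here; the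
step rate NOT PRINTED — rows NE2 ∕ NE3 ∕ NE5 (N15 ∕ N16 ∕ N18) in the record's letters. [cite: Balaban1987RG1, (1.21)-(1.22) p.264 and (5.10) p.293] -/
theorem N17_datumOfRecord₁₁_of_kernelStepRate (θ : Stage11Params F N) (h : θ.Provisos₁₁) {C δ C' δ' ρ γ' : ℝ} (hγ : γ' ≤ θ.γ)
    (hγ' : 0 < γ') (hρ0 : 0 ≤ ρ) (hρ1 : ρ < 1) (hδ : 0 < δ) (hδ' : 0 < δ')
    (hU : letI := θ.instVβ₁; letI := θ.instVβ₂; letI := θ.instιβ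
      ∀ k (v : Fin (k + 1) → ℝ), v ∈ Box γ' k →
        Decay510 (polLimit F (k + 1)
          (fun K => mergedTermFamilyMatT F N (TcOfRecord F N) (chiFixed7 F N θ.ν) θ.εbg k v K) θ.ρ8 θ.bV 0 1) C δ)
    (hS : letI := θ.instVβ₁; letI := θ.instVβ₂; letI := θ.instιβ
      ∀ k (w : Fin (k + 2) → ℝ), w ∈ Box γ' (k + 1) →
        Decay510 (subKernel
          (polLimit F (k + 1 + 1) (fun K => mergedTermFamilyMatT F N (TcOfRecord F N) (chiFixed7 F N θ.ν) θ.εbg (k + 1) w K) θ.ρ8 θ.bV)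
          (polLimit F (k + 1) (fun K => mergedTermFamilyMatT F N (TcOfRecord F N) (chiFixed7 F N θ.ν) θ.εbg k (Fin.tail w) K) θ.ρ8 θ.bV)
            0 1) (C' * ρ ^ k) δ')
    (hlim : letI := θ.instVβ₁; letI := θ.instVβ₂; letI := θ.instιβ
      Beta0LimitExists (betaMerged F (mergedTermFamilyMatT F N (TcOfRecord F N) (chiFixed7 F N θ.ν) θ.εbg) θ.ρ8 θ.bV) θ.v₀)
    (hcoh : ∀ k, Fin.tail (θ.v₀ (k + 1)) = θ.v₀ k) (hadm : ∀ k i, 0 < θ.v₀ k i ∧ θ.v₀ k i ≤ γ') :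
    NE4OnData (datumOfRecord₁₁ F N θ h) (betaPrime510 4 C' δ') ρ γ' ∧
      letI := θ.instVβ₁; letI := θ.instVβ₂; letI := θ.instιβ
      ∃ binf : ℝ, ∀ k,
        |beta0OfMerged (betaMerged F (mergedTermFamilyMatT F N (TcOfRecord F N) (chiFixed7 F N θ.ν) θ.εbg) θ.ρ8 θ.bV) θ.v₀ k - binf| ≤
          betaPrime510 4 C' δ' / (1 - ρ) * ρ ^ k := by
  letI := θ.instVβ₁; letI := θ.instVβ₂; letI := θ.instιβ
  exact N17_atAssemblyLine_of_kernelStepRate _ _ θ.ρ8 θ.bV (βfun_datumOfRecord₁₁_eq_mergedT θ h) hγ hγ' hρ0 hρ1 hδ hδ' hU hS hlim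
    hcoh hadm

/-- **THE CAP AT STAGE 11, as an `iff`** (companion 5 §20 at `βfun_datumOfRecord₁₁_eq_mergedT`): at admissible Stage-11 parameters, on a box LARGER than the
record box (`θ.γ < γ'`) the datum satisfies `NE4OnData D₁₁ c ρ γ'` IFF `βmT` satisfies NE4 on the record box ∧ is uniformly `cρ^k`-close on the record box to
the next one-loop number `beta0OfMerged βmT θ.v₀ (k+1)` ∧ the one-loop numbers of record are geometrically Cauchy — the crux text takes `γ' ≤ θ.γ`.
[cite: Balaban1987RG1, (1.22) p.264 («defined on the interval [0, γ]»)] -/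
theorem N17_datumOfRecord₁₁_iff_of_lt (θ : Stage11Params F N) (h : θ.Provisos₁₁) (hθ : θ.Admissible) {c ρ γ' : ℝ} (hlt : θ.γ < γ') :
    NE4OnData (datumOfRecord₁₁ F N θ h) c ρ γ' ↔
      letI := θ.instVβ₁; letI := θ.instVβ₂; letI := θ.instιβ
      ScaleShiftRate c ρ θ.γ (betaMerged F (mergedTermFamilyMatT F N (TcOfRecord F N) (chiFixed7 F N θ.ν) θ.εbg) θ.ρ8 θ.bV) ∧
        (∀ k (v : Fin (k + 1) → ℝ), v ∈ Box θ.γ k →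
          |beta0OfMerged (betaMerged F (mergedTermFamilyMatT F N (TcOfRecord F N) (chiFixed7 F N θ.ν) θ.εbg) θ.ρ8 θ.bV) θ.v₀ (k + 1) -
              betaMerged F (mergedTermFamilyMatT F N (TcOfRecord F N) (chiFixed7 F N θ.ν) θ.εbg) θ.ρ8 θ.bV k v| ≤ c * ρ ^ k) ∧
        (∀ k, |beta0OfMerged (betaMerged F (mergedTermFamilyMatT F N (TcOfRecord F N) (chiFixed7 F N θ.ν) θ.εbg) θ.ρ8 θ.bV) θ.v₀ (k + 1) -
            beta0OfMerged (betaMerged F (mergedTermFamilyMatT F N (TcOfRecord F N) (chiFixed7 F N θ.ν) θ.εbg) θ.ρ8 θ.bV) θ.v₀ k| ≤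
          c * ρ ^ k) := by
  letI := θ.instVβ₁; letI := θ.instVβ₂; letI := θ.instιβ
  have h0 : 0 < θ.γ := hθ.toStage9.gamma_pos
  rw [ne4OnData_iff, βfun_datumOfRecord₁₁_eq_mergedT]
  exact scaleShiftRate_betaOfMerged_iff_of_lt (h0.trans hlt) hlt

/-! ## §32 N17 AT THE RECORD PREDICATE `IsRecordOfRecord₁₁C F N D w` — ∀-forms over admissible θ WITH `Provisos₁₁` (charted, β-version certified) -/

/-- **N17 AT A STAGE-11 RECORD `(D, w)`.**  If at EVERY admissible Stage-11 parameter with its provisos whose datum is `D` and whose record box contains the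
world's window the continuous-version merged β `βmT` satisfies `ScaleShiftRate cN ρ w.γ`, then `NE4OnData D cN ρ w.γ` — the chart clause
(`Admissible.toStage9.chart`), the β-version proviso (`Provisos₁₁.hasContTransportAlong`), the box side `w.γ ≤ θ.γ` and its positivity being CLAUSES of
`IsRecordOfRecord₁₁C`.  Hypothesis displayed, not asserted. [cite: Balaban1987RG1, (1.20)-(1.22) p.264; Balaban1989LargeFieldII, Thm 1 p.355] -/
theorem N17_of_isRecordOfRecord₁₁C {D : Datum F N} {w : WorldP} (h : IsRecordOfRecord₁₁C F N D w) {cN ρ : ℝ}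
    (hin : ∀ (θ : Stage11Params F N) (hP : θ.Provisos₁₁), θ.Admissible → D = datumOfRecord₁₁ F N θ hP → w.γ ≤ θ.γ →
      letI := θ.instVβ₁; letI := θ.instVβ₂; letI := θ.instιβ
      ScaleShiftRate cN ρ w.γ (betaMerged F (mergedTermFamilyMatT F N (TcOfRecord F N) (chiFixed7 F N θ.ν) θ.εbg) θ.ρ8 θ.bV)) :
    NE4OnData D cN ρ w.γ := by
  obtain ⟨θ, hP, hθ, hD, -, ⟨-, hγle⟩, -, -⟩ := h
  have hm := hin θ hP hθ hD hγle
  subst hD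
  exact (N17_datumOfRecord₁₁_iff_merged θ hP hγle).mpr hm

/-- **N17 AT A STAGE-11 RECORD BY THE SPLIT ROAD**: (AF-0r) for `beta0OfMerged βmT θ.v₀` (constant `c₀ ≥ 0`; N15's currency) ∧ the merged remainder's rate
(constant `c₁`; N16 ∕ N18) on the world's window, asked of every admissible witness with provisos, `0 ≤ ρ ≤ 1` ⟹ `NE4OnData D (2c₀ + c₁) ρ w.γ`.
[cite: Balaban1987RG1, (2.12)-(2.14) p.268] -/
theorem N17_of_isRecordOfRecord₁₁C_rates {D : Datum F N} {w : WorldP} (h : IsRecordOfRecord₁₁C F N D w) {c₀ c₁ ρ : ℝ}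
    (hρ0 : 0 ≤ ρ) (hρ1 : ρ ≤ 1) (hc₀ : 0 ≤ c₀)
    (hin : ∀ (θ : Stage11Params F N) (hP : θ.Provisos₁₁), θ.Admissible → D = datumOfRecord₁₁ F N θ hP → w.γ ≤ θ.γ →
      letI := θ.instVβ₁; letI := θ.instVβ₂; letI := θ.instιβ
      ∃ binf : ℝ,
        (∀ k, |beta0OfMerged (betaMerged F (mergedTermFamilyMatT F N (TcOfRecord F N) (chiFixed7 F N θ.ν) θ.εbg) θ.ρ8 θ.bV) θ.v₀ k -
            binf| ≤ c₀ * ρ ^ k) ∧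
        ScaleShiftRate c₁ ρ w.γ fun k v =>
          betaMerged F (mergedTermFamilyMatT F N (TcOfRecord F N) (chiFixed7 F N θ.ν) θ.εbg) θ.ρ8 θ.bV k v -
            beta0OfMerged (betaMerged F (mergedTermFamilyMatT F N (TcOfRecord F N) (chiFixed7 F N θ.ν) θ.εbg) θ.ρ8 θ.bV) θ.v₀ k) :
    NE4OnData D (2 * c₀ + c₁) ρ w.γ := by
  obtain ⟨θ, hP, hθ, hD, -, ⟨-, hγle⟩, -, -⟩ := h
  obtain ⟨binf, hconv, hrem⟩ := hin θ hP hθ hD hγle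
  subst hD
  exact N17_datumOfRecord₁₁_of_rates θ hP hγle hρ0 hρ1 hc₀ hconv hrem

/-- **N17 AT A STAGE-11 RECORD IN KERNEL CURRENCY — the content form.**  (UD) ((5.10)-decay, some `C`, `δ > 0` per witness) ∧ the HISTORY-MATCHED STEP RATE
`|Π_{k+2}(w; x) − Π_{k+1}(tail w; x)| ≤ C′ρ^k e^{−δ′|x|₁}` (fixed `C′`, `δ′ > 0`) of the record's OWN limiting polarisation kernels `Node00.polLimit` of the
`(TcOfRecord, chiFixed7)` merged term family, read through the (charted) `(θ.ρ8, θ.bV)`, on the world's window, asked of every admissible Stage-11 witness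
with provisos ⟹ `NE4OnData D (β′(C′,δ′)) ρ w.γ` (companion 4 `scaleShiftRate_betaMerged_of_kernelStepRate`).  (UD) PRINTED for Bałaban's kernels, the step
rate NOT (rows NE2 ∕ NE3 ∕ NE5 = N15 ∕ N16 ∕ N18 in the record's letters). [cite: Balaban1987RG1, (1.21)-(1.22) p.264 and (5.10) p.293] -/
theorem N17_of_isRecordOfRecord₁₁C_kernelStepRate {D : Datum F N} {w : WorldP} (h : IsRecordOfRecord₁₁C F N D w) {C' δ' ρ : ℝ}
    (hδ' : 0 < δ')
    (hin : ∀ (θ : Stage11Params F N) (hP : θ.Provisos₁₁), θ.Admissible → D = datumOfRecord₁₁ F N θ hP → w.γ ≤ θ.γ →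
      letI := θ.instVβ₁; letI := θ.instVβ₂; letI := θ.instιβ
      (∃ C δ : ℝ, 0 < δ ∧ ∀ k (v : Fin (k + 1) → ℝ), v ∈ Box w.γ k →
        Decay510 (polLimit F (k + 1)
          (fun K => mergedTermFamilyMatT F N (TcOfRecord F N) (chiFixed7 F N θ.ν) θ.εbg k v K) θ.ρ8 θ.bV 0 1) C δ) ∧
      (∀ k (u : Fin (k + 2) → ℝ), u ∈ Box w.γ (k + 1) →
        Decay510 (subKernel
          (polLimit F (k + 1 + 1) (fun K => mergedTermFamilyMatT F N (TcOfRecord F N) (chiFixed7 F N θ.ν) θ.εbg (k + 1) u K) θ.ρ8 θ.bV)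
          (polLimit F (k + 1) (fun K => mergedTermFamilyMatT F N (TcOfRecord F N) (chiFixed7 F N θ.ν) θ.εbg k (Fin.tail u) K) θ.ρ8 θ.bV)
            0 1) (C' * ρ ^ k) δ')) :
    NE4OnData D (betaPrime510 4 C' δ') ρ w.γ := by
  obtain ⟨θ, hP, hθ, hD, -, ⟨-, hγle⟩, -, -⟩ := h
  obtain ⟨⟨C, δ, hδ, hU⟩, hS⟩ := hin θ hP hθ hD hγle
  subst hD
  letI := θ.instVβ₁; letI := θ.instVβ₂; letI := θ.instιβ
  exact (N17_datumOfRecord₁₁_iff_merged θ hP hγle).mpr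
    (scaleShiftRate_betaMerged_of_kernelStepRate F (mergedTermFamilyMatT F N (TcOfRecord F N) (chiFixed7 F N θ.ν) θ.εbg) θ.ρ8 θ.bV
      hδ hδ' hU hS)

/-- **NODE U2's INPUT TRIPLE AT A STAGE-11 RECORD** (the N17 → N27 edge's input): N17 ∧ the history moduli OF `βmT` on the world's window, asked of every
admissible witness with provisos, ∧ the β-free fading-memory clause ⟹ `U2Inputs D cN C ρ w.γ Λ`. [cite: Balaban1987RG1, §5 p.298] -/
theorem u2Inputs_of_isRecordOfRecord₁₁C {D : Datum F N} {w : WorldP} (h : IsRecordOfRecord₁₁C F N D w) {cN C ρ : ℝ}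
    {Λ : ℕ → ℕ → ℝ} (hF : FadingMemory C ρ Λ)
    (hin : ∀ (θ : Stage11Params F N) (hP : θ.Provisos₁₁), θ.Admissible → D = datumOfRecord₁₁ F N θ hP → w.γ ≤ θ.γ →
      letI := θ.instVβ₁; letI := θ.instVβ₂; letI := θ.instιβ
      ScaleShiftRate cN ρ w.γ (betaMerged F (mergedTermFamilyMatT F N (TcOfRecord F N) (chiFixed7 F N θ.ν) θ.εbg) θ.ρ8 θ.bV) ∧
        HistLipschitz Λ w.γ (betaMerged F (mergedTermFamilyMatT F N (TcOfRecord F N) (chiFixed7 F N θ.ν) θ.εbg) θ.ρ8 θ.bV)) :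
    U2Inputs D cN C ρ w.γ Λ := by
  obtain ⟨θ, hP, hθ, hD, -, ⟨-, hγle⟩, -, -⟩ := h
  obtain ⟨hm, hL⟩ := hin θ hP hθ hD hγle
  subst hD
  exact (u2Inputs_datumOfRecord₁₁_iff θ hP hγle).mpr ⟨hm, hL, hF⟩

/-- **`2 ≤ N`: N17 AT A ₁₁C RECORD IS AN η-RATE STATEMENT ABOUT THE CONTINUOUS-VERSION MERGED β THROUGH A GENUINE CHART, AT A WITNESS CERTIFYING THE
β-VERSION PROVISO** (kernel): from `IsRecordOfRecord₁₁C F N D w` and `NE4OnData D c ρ w.γ` one obtains an admissible Stage-11 witness θ with provisos,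
`θ.ρ8 ≠ 0` (`Admissible.toStage9.chart` + `IsChartOfRecord.rho8_ne_zero`), `θ.toStage8Params.HasContTransportAlong` (`Provisos₁₁.hasContTransportAlong` —
RIDER №6 (b) absent), `w.γ ≤ θ.γ`, `D` its datum, AND `ScaleShiftRate c ρ w.γ βmT`. [cite: Balaban1987RG1, (0.13) p.254 and (1.20)-(1.22) p.264] -/
theorem exists_chart_scaleShiftRate_of_N17₁₁ {D : Datum F N} {w : WorldP} (h : IsRecordOfRecord₁₁C F N D w) (hN : 2 ≤ N) {c ρ : ℝ}
    (hN17 : NE4OnData D c ρ w.γ) :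
    ∃ (θ : Stage11Params F N) (hP : θ.Provisos₁₁), θ.Admissible ∧ (letI := θ.instVβ₁; letI := θ.instVβ₂; θ.ρ8) ≠ 0 ∧
      θ.toStage8Params.HasContTransportAlong ∧ w.γ ≤ θ.γ ∧ D = datumOfRecord₁₁ F N θ hP ∧
      letI := θ.instVβ₁; letI := θ.instVβ₂; letI := θ.instιβ
      ScaleShiftRate c ρ w.γ (betaMerged F (mergedTermFamilyMatT F N (TcOfRecord F N) (chiFixed7 F N θ.ν) θ.εbg) θ.ρ8 θ.bV) := by
  obtain ⟨θ, hP, hθ, hD, -, ⟨-, hγle⟩, -, -⟩ := h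
  refine ⟨θ, hP, hθ, hθ.toStage9.chart.2.rho8_ne_zero hθ.toStage9.chart.1 hN, hP.hasContTransportAlong, hγle, hD, ?_⟩
  subst hD
  exact (N17_datumOfRecord₁₁_iff_merged θ hP hγle).mp hN17

/-- **WHAT N17 DELIVERS AT A STAGE-11 RECORD: (AF-0r) FOR THE RECORD's ONE-LOOP NUMBERS** (companion 4 `af0r_of_N17_atRecord`): `NE4OnData D c ρ w.γ` with
`ρ < 1`, and — asked of every admissible witness with provisos realising `D` — `Beta0LimitExists βmT θ.v₀` at COHERENT reference histories with entries in
`]0, w.γ]` ⟹ some such witness θ with `∃ β⁰_∞, |beta0OfMerged βmT θ.v₀ k − β⁰_∞| ≤ (c∕(1−ρ))ρ^k` — the `hconv` input of NODE O ∕ K2's consumers, SUPPLIED by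
the node at the record (β⁰-side hypotheses displayed, not asserted; `0 < w.γ` is the record's clause). [cite: Balaban1987RG1, (2.12)-(2.14) p.268] -/
theorem af0r_of_N17_isRecordOfRecord₁₁C {D : Datum F N} {w : WorldP} (h : IsRecordOfRecord₁₁C F N D w) {c ρ : ℝ} (hρ1 : ρ < 1)
    (hN17 : NE4OnData D c ρ w.γ)
    (hin : ∀ (θ : Stage11Params F N) (hP : θ.Provisos₁₁), θ.Admissible → D = datumOfRecord₁₁ F N θ hP → w.γ ≤ θ.γ →
      (letI := θ.instVβ₁; letI := θ.instVβ₂; letI := θ.instιβ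
        Beta0LimitExists (betaMerged F (mergedTermFamilyMatT F N (TcOfRecord F N) (chiFixed7 F N θ.ν) θ.εbg) θ.ρ8 θ.bV) θ.v₀) ∧
      (∀ k, Fin.tail (θ.v₀ (k + 1)) = θ.v₀ k) ∧ ∀ k i, 0 < θ.v₀ k i ∧ θ.v₀ k i ≤ w.γ) :
    ∃ (θ : Stage11Params F N) (hP : θ.Provisos₁₁), θ.Admissible ∧ D = datumOfRecord₁₁ F N θ hP ∧
      letI := θ.instVβ₁; letI := θ.instVβ₂; letI := θ.instιβ
      ∃ binf : ℝ, ∀ k,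
        |beta0OfMerged (betaMerged F (mergedTermFamilyMatT F N (TcOfRecord F N) (chiFixed7 F N θ.ν) θ.εbg) θ.ρ8 θ.bV) θ.v₀ k - binf| ≤
          c / (1 - ρ) * ρ ^ k := by
  obtain ⟨θ, hP, hθ, hD, -, ⟨hγ0, hγle⟩, -, -⟩ := h
  obtain ⟨hlim, hcoh, hadm⟩ := hin θ hP hθ hD hγle
  refine ⟨θ, hP, hθ, hD, ?_⟩
  subst hD
  letI := θ.instVβ₁; letI := θ.instVβ₂; letI := θ.instιβ
  exact af0r_of_N17_atRecord _ (βfun_datumOfRecord₁₁_eq_mergedT θ hP) hγle hγ0 hρ1 hlim hcoh hadm hN17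

/-- **EVERY ₁₁C RECORD HAS def-T's STAGE-5 SHADOW WITH THE SAME β-FUNCTIONS, AT WHICH N17 IS THE SAME STATEMENT** [bookkeeping]
(`Record11.exists_isRecordOfRecord₅C_of_isRecordOfRecord₁₁C`): the §2-[III]-format pin and the tower datum concern `dens ∕ R ∕ Sect2Form`, not `βfun`.
[cite: Balaban1989LargeFieldII, Thm 1 p.355 (bookkeeping)] -/
theorem exists_shadow₅_N17_iff₁₁ {D : Datum F N} {w : WorldP} (h : IsRecordOfRecord₁₁C F N D w) :
    ∃ D₅ : Datum F N, IsRecordOfRecord₅C F N D₅ w ∧ D₅.βfun = D.βfun ∧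
      ∀ (c ρ γ' : ℝ), NE4OnData D c ρ γ' ↔ NE4OnData D₅ c ρ γ' := by
  obtain ⟨D₅, h5, -, -, hβ, -⟩ := exists_isRecordOfRecord₅C_of_isRecordOfRecord₁₁C h
  exact ⟨D₅, h5, hβ, fun c ρ γ' => by rw [ne4OnData_iff, ne4OnData_iff, hβ]⟩

/-- **N17 AT node00-def's QUADRUPLY PINNED STAGE-11 RECORD `IsRecordOfRecord₁₁CB10YZW`** — same datum, same world
(`isRecordOfRecord₁₁C_of_isRecordOfRecord₁₁CB10YZW`), so §32's ∀-form applies verbatim. [cite: Balaban1987RG1, (1.20)-(1.22) p.264; Balaban1989LargeFieldII, Thm 1 p.355] -/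
theorem N17_of_isRecordOfRecord₁₁CB10YZW {D : Datum F N} {w : WorldP} (h : IsRecordOfRecord₁₁CB10YZW F N D w) {cN ρ : ℝ}
    (hin : ∀ (θ : Stage11Params F N) (hP : θ.Provisos₁₁), θ.Admissible → D = datumOfRecord₁₁ F N θ hP → w.γ ≤ θ.γ →
      letI := θ.instVβ₁; letI := θ.instVβ₂; letI := θ.instιβ
      ScaleShiftRate cN ρ w.γ (betaMerged F (mergedTermFamilyMatT F N (TcOfRecord F N) (chiFixed7 F N θ.ν) θ.εbg) θ.ρ8 θ.bV)) :
    NE4OnData D cN ρ w.γ :=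
  N17_of_isRecordOfRecord₁₁C (isRecordOfRecord₁₁C_of_isRecordOfRecord₁₁CB10YZW h) hin

/-- **N17 AT node00-def's FIVE-PIN STAGE-11 RECORD `IsRecordOfRecord₁₁CB10YZWB8`** ([B8] pin surviving): the predicate names an admissible Stage-11 θ with
provisos realising `D` and the window clause `0 < w.γ ≤ θ.γ` exactly as ₁₁C does. [cite: Balaban1987RG1, (1.20)-(1.22) p.264; Balaban1989LargeFieldII, Thm 1 p.355] -/
theorem N17_of_isRecordOfRecord₁₁CB10YZWB8 {D : Datum F N} {w : WorldP} (h : IsRecordOfRecord₁₁CB10YZWB8 F N D w) {cN ρ : ℝ}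
    (hin : ∀ (θ : Stage11Params F N) (hP : θ.Provisos₁₁), θ.Admissible → D = datumOfRecord₁₁ F N θ hP → w.γ ≤ θ.γ →
      letI := θ.instVβ₁; letI := θ.instVβ₂; letI := θ.instιβ
      ScaleShiftRate cN ρ w.γ (betaMerged F (mergedTermFamilyMatT F N (TcOfRecord F N) (chiFixed7 F N θ.ν) θ.εbg) θ.ρ8 θ.bV)) :
    NE4OnData D cN ρ w.γ := by
  obtain ⟨θ, hP, -, -, -, -, -, hθ, hD, -, ⟨-, hγle⟩, -, -⟩ := h
  have hm := hin θ hP hθ hD hγle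
  subst hD
  exact (N17_datumOfRecord₁₁_iff_merged θ hP hγle).mpr hm

/-! ## §33 THE LINK TO CLUSTER K4's STUB `YMDAG.UVSplit.S_N17 RRec` AT STAGE 11 -/

/-- **(W2) CLOSER — `S_N17 RRec` FOR EVERY RATE RECORD READING THE STAGE-11 RECORD WITH THE RATE** (kernel): if every bundle `R` of record for `(F, D, g₀, os)`
comes with an admissible Stage-11 witness θ WITH ITS PROVISOS realising `D`, with `R.u3.γ ≤ θ.γ`, at which `βmT` has the η-rate at `R.u3`'s dependent letters,
then `S_N17 RRec` — the one-application closer for an `RRec` home typed over `Stage11Params` (admissibility carries the chart clause: R448-countable). [cite: Balaban1987RG1, (1.20)-(1.22) p.264] -/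
theorem s_N17_of_stage11_slot (RRec : RateRecordPred N)
    (hslot : ∀ (F : T4Family) (D : Datum F N) (g₀ : ℕ → ℝ) (os : List (ULoop F)) (R : RateCarriers N), RRec F D g₀ os R →
      ∃ (θ : Stage11Params F N) (hP : θ.Provisos₁₁), θ.Admissible ∧ D = datumOfRecord₁₁ F N θ hP ∧ R.u3.γ ≤ θ.γ ∧
        letI := θ.instVβ₁; letI := θ.instVβ₂; letI := θ.instιβ
        ScaleShiftRate (R.u3.cr * R.u3.C₅ * R.u3.θ) R.u3.ρ R.u3.γ
          (betaMerged F (mergedTermFamilyMatT F N (TcOfRecord F N) (chiFixed7 F N θ.ν) θ.εbg) θ.ρ8 θ.bV)) :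
    S_N17 RRec := by
  intro F D g₀ os R hR
  obtain ⟨θ, hP, -, hD, hγ, hm⟩ := hslot F D g₀ os R hR
  subst hD
  exact (n17At_datumOfRecord₁₁_iff_merged θ hP R.u3 hγ).mpr hm

/-- **(W2) CLOSER FOR AN `RRec` HOME KEYED TO `IsRecordOfRecord₁₁C`**: if every bundle `R` of record for `(F, D, g₀, os)` comes with a world `w` making
`(D, w)` a Stage-11 record whose window IS node U3's box (`R.u3.γ = w.γ`), and the `βmT` rate at `R.u3`'s letters is supplied in §32's ∀-form, then `S_N17 RRec`.
Stage-free alternatives (not restated): `YMDAG.N17.s_N17_of_D4_N18` (U3 road), `YMDAG.N17.n17At_of_transferModel` (IN n15 ∕ n16). [cite: Balaban1987RG1, (1.20)-(1.22) p.264] -/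
theorem s_N17_of_rec₁₁C (RRec : RateRecordPred N)
    (hhome : ∀ (F : T4Family) (D : Datum F N) (g₀ : ℕ → ℝ) (os : List (ULoop F)) (R : RateCarriers N), RRec F D g₀ os R →
      ∃ w : WorldP, IsRecordOfRecord₁₁C F N D w ∧ R.u3.γ = w.γ)
    (hin : ∀ (F : T4Family) (D : Datum F N) (g₀ : ℕ → ℝ) (os : List (ULoop F)) (R : RateCarriers N), RRec F D g₀ os R →
      ∀ (θ : Stage11Params F N) (hP : θ.Provisos₁₁), θ.Admissible → D = datumOfRecord₁₁ F N θ hP → R.u3.γ ≤ θ.γ →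
        letI := θ.instVβ₁; letI := θ.instVβ₂; letI := θ.instιβ
        ScaleShiftRate (R.u3.cr * R.u3.C₅ * R.u3.θ) R.u3.ρ R.u3.γ
          (betaMerged F (mergedTermFamilyMatT F N (TcOfRecord F N) (chiFixed7 F N θ.ν) θ.εbg) θ.ρ8 θ.bV)) :
    S_N17 RRec := by
  intro F D g₀ os R hR
  obtain ⟨w, hw, hγ⟩ := hhome F D g₀ os R hR
  show NE4OnData D _ _ _
  rw [hγ]
  exact N17_of_isRecordOfRecord₁₁C hw fun θ hP hθ hD hle => hγ ▸ hin F D g₀ os R hR θ hP hθ hD (hγ.le.trans hle)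

/-- **THE (D4) READ-OUT BINDERS AT A STAGE-11 DATUM ARE STATEMENTS ABOUT THE CONTINUOUS-VERSION β OF RECORD** [bookkeeping]: module 2's `ReadOutAt` at the
Stage-11 datum = at the Stage-10 datum of `θ.toStage9Params` (`βfun` identity of §31); there `ReadOutAt (datumOfRecord₁₁ F N θ h) u` asks the two runs' output
functionals to REPRESENT `betaOfRecord₉c F N θ.toStage9Params` on the `u.γ`-boxes, so companion 6's stage-free glue `YMDAG.N17.s_N17_of_D4_N18` closes `S_N17`
from `S_D4 ∧ S_N18` for any `RRec` home over ₁₁C. [cite: Balaban1987RG1, (1.20)-(1.22) p.264] -/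
theorem readOutAt_datumOfRecord₁₁_iff_stage10 (θ : Stage11Params F N) (h : θ.Provisos₁₁) (u : U3Carriers) :
    YMDAG.UVSplit.ReadOutAt (datumOfRecord₁₁ F N θ h) u ↔
      YMDAG.UVSplit.ReadOutAt (datumOfRecord₁₀ F N θ.toStage9Params h.base) u := by
  unfold YMDAG.UVSplit.ReadOutAt
  rw [βfun_datumOfRecord₁₁_eq_stage10]

end Summit.QuantumFields.YangMills.Theorems.BalabanUVNodesN17

end
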